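/-
Copyright (c) 2026 the pub-hodgecm-mathlib formalisation cell (harness21).  Prover seat hodgecm-mathlib-K2E1-p15 (g0), Track B ∕ K2-LIT «5Res», h413 = `stmt-HodgeConjecture-24833`,
line `K2_E1_TraceFormulaBeta`, route of record `HCCMUnconditional`; dealer K2E1-plan (g7) PRIORITY DEAL D6′-soft (K2 bus 2026-09-04T12:34:59Z): «5Res ⟸ ADMISSIBILITY OF
L²_res» BY NAME — the sockets `sig_K2E1ResidualCompactU2` ∕ `sig_K2E1ResidualCompactU3R` (Sigs ED. 12 :247 ∕ :293) from the `∀ L μ`-package «every irreducible `K`-type of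
`L²_res` has a finite-dimensional isotypic component», over ★ `K2E1ResidualCompactOfAdmissible` (K2E1-p02).
-/
import Summits.HodgeConjecture.HodgeConjecture.Theorems.K2E1ResidualCompactOfAdmissible   -- ★ (K2E1-p02 g4): `residualSpectrumCompact_of_admissible`, `cmResidualSpectrumCompactR_of_admissible`
import HarnessLib

/-!
# K2·E1 — `K2E1ResidualCompactOfAdmissibleU2`: THE SOCKETS 5Res ∕ 12R3 BY NAME ⟸ «`L²_res(U(Φ_N)_{L∕L⁺})` IS `K`-ADMISSIBLE» (the `∀ L μ`-package, D6′-soft)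

Track B ∕ K2-LIT, crux h413 = `stmt-HodgeConjecture-24833`; cell `hodgecm-mathlib`, squad K2, ENGINE E1 (socket module `K2_E1_TraceFormulaBetaSigs_GlobalIndex` ED. 12; live
sockets 5Res = `sig_K2E1ResidualCompactU2` :247 `∀ L μ, CmResidualSpectrumCompact L 2 μ`, 12R3 = `sig_K2E1ResidualCompactU3R` :293 `∀ L μ, CmResidualSpectrumCompactR L 3 μ`).
THEOREMS ONLY (no `def`, no `instance`, no notation, no named-fact hypothesis, no `sorry`); lane `--kind proof --supports stmt-HodgeConjecture-24833 --as helper` (count-neutral).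
CLOSES NO SOCKET — it is the kernel-checked reading «5Res ∕ 12R3 ⟸ admissibility of `L²_res`», making the ENDGAME TARGET of M1∕M2 the single statement «every irreducible
`K`-isotypic component of `L²_res(U(1,1)_{L∕L⁺})` is finite-dimensional».

WHAT ([MoeglinWaldspurger1995, I.2.18, V.3.13]; [HarishChandra1968, Thm. 1]; [BorelWallach2000, 0 §2.3]).  ★ `K2E1ResidualCompactOfAdmissible.residualSpectrumCompact_of_admissible`
(K2E1-p02) proves, for ANY adelic datum: if `L²_res` is `K`-admissible for some compact Hausdorff `K →* G(𝔸)` (every finite-dimensional irreducible `K`-stable `E ≤ L²_res` has a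
finite-dimensional isotypic part ★ `Representation.homRangeSum`), then `R(f)|_{L²_res}` is compact for every Haar measure and every `f ∈ C_c` — via `‖σ(ψ₀)π(f) − π(f)‖ → 0`,
Peter–Weyl and finite rank, with NO constant terms and NO Eisenstein theory.  This file prints it in the SOCKET SHAPE: hypothesis = the `∀ L μ`-package (for every CM field `L` and
every automorphic `μ` there is a compact Hausdorff `K` with a continuous `ιK : K →* U(Φ_N)(𝔸_{L⁺})` making `L²_res` admissible), conclusion = Sigs :247 ∕ :293 VERBATIM.
* §1 **`sig_K2E1ResidualCompactU2_of_admissible`** (5Res, `N = 2`, radicals ★ `cmParabolicData L 2`) and **`sig_K2E1ResidualCompactU3R_of_admissible`** (12R3, `N = 3`, Heisenberg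
  radical of record ★ `cmParabolicDataR L 3`) — LEAN hypothesis (`∃ K … ιK, Continuous ιK ∧ admissible`).
* §2 **`sig_K2E1ResidualCompactU2_of_admissible'`** ∕ **`sig_K2E1ResidualCompactU3R_of_admissible'`** — the SAME with the `∃`-prefix of ★ `sig_K2E1ResidualCompactU2_of_exp` :45
  (Borel structures on the radicals, `νN`, `𝓕` — carried and discarded), so a payer holding the (H4-b)-shaped package with «`∃ T` finite-dimensional» replaced by «isotypic component
  finite-dimensional» plugs in byte-for-byte.
NOT HERE (dealer: «if cheap, else leave the isotypic form»): the reduction «admissible ⟸ `(L²_res)^{(τ, K_f(𝔫))}` finite-dimensional for all `τ, 𝔫`» needs the tensor-product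
structure of the irreducible representations of `K_∞ × K_f` and is left to a sequel.

HONEST LABEL: HC_CM is proved only modulo the 7 printed citations (2 remaining named inputs: hLiu418 = `stmt-HodgeConjecture-24832`, h413 = `stmt-HodgeConjecture-24833`) until rung 0
closes; this file asserts no named fact and closes no socket (5Res ∕ 12R3 stay OPEN until admissibility is ★).

## References
* [MoeglinWaldspurger1995] C. Mœglin, J.-L. Waldspurger, *Spectral decomposition and Eisenstein series* (1995), I.2.18, V.3.13.
* [HarishChandra1968] Harish-Chandra, *Automorphic forms on semisimple Lie groups*, LNM 62 (1968), Thm. 1.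
* [BorelWallach2000] A. Borel, N. Wallach, *Continuous cohomology, discrete subgroups, and representations of reductive groups*, 2nd ed. (2000), 0 §2.3.
* [Rogawski1990] J. Rogawski, *Automorphic representations of unitary groups in three variables* (1990), §13.5 pp. 204–206, §13.9 p. 227.
-/

set_option autoImplicit false
set_option linter.dupNamespace false  -- the mandated namespace repeats the summit's segment (`HodgeConjecture.HodgeConjecture`)

noncomputable section

open MeasureTheory Measure Topology NumberField IsDedekindDomain
open Literature.NumberTheory.Automorphic Literature.NumberTheory.Automorphic.UnitaryGroup AdelicGroupData
open Summit.HodgeConjecture.HodgeConjecture.Cruxes.H413.K2E1CuspidalSpectrumUnitary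
open Summit.HodgeConjecture.HodgeConjecture.Cruxes.H413.K2E1ResidualCompactOfAdmissible (residualSpectrumCompact_of_admissible)

namespace Summit.HodgeConjecture.HodgeConjecture.Cruxes.H413.K2E1ResidualCompactOfAdmissibleU2

/-! ## §1 The sockets from the lean admissibility package -/

/-- **SOCKET 5Res BY NAME: `sig_K2E1ResidualCompactU2` (Sigs ED. 12 :247, bytes verbatim) ⟸ «for every CM field `L` and every automorphic `μ`, `L²_res(U(Φ₂)_{L∕L⁺})` is `K`-admissible
for some compact Hausdorff `K →* U(Φ₂)(𝔸_{L⁺})`»** (★ `residualSpectrumCompact_of_admissible` at the datum `cmDatum L 2 Φ₂` and the radicals ★ `cmParabolicData L 2`).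
[cite: MoeglinWaldspurger1995, I.2.18 and V.3.13] [cite: HarishChandra1968, Thm. 1] [cite: BorelWallach2000, 0 §2.3] -/
theorem sig_K2E1ResidualCompactU2_of_admissible
    (h : ∀ (L : Type) [Field L] [NumberField L] [IsCMField L]
      (μ : Measure (UnitaryGroup.cmDatum L 2 (Matrix.of fun i j : Fin 2 => if i.val + j.val + 1 = 2 then (1 : L) else 0)).automorphicQuotient)
      [(UnitaryGroup.cmDatum L 2 (Matrix.of fun i j : Fin 2 => if i.val + j.val + 1 = 2 then (1 : L) else 0)).IsAutomorphicMeasure μ],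
      ∃ (K : Type) (_ : Group K) (_ : TopologicalSpace K) (_ : IsTopologicalGroup K) (_ : CompactSpace K) (_ : T2Space K)
        (ιK : K →* (UnitaryGroup.cmDatum L 2 (Matrix.of fun i j : Fin 2 => if i.val + j.val + 1 = 2 then (1 : L) else 0)).Adelic) (_ : Continuous ιK),
        ∀ (E : Submodule ℂ (cmResidualSubspace L 2 μ).toSubmodule) (hE : ∀ k, ∀ x ∈ E, ((cmResidualSubspace L 2 μ).toContRep.restrict ιK) k x ∈ E),
          FiniteDimensional ℂ E → (((cmResidualSubspace L 2 μ).toContRep.restrict ιK).subRep E hE).IsIrreducible →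
          FiniteDimensional ℂ ↥(Representation.homRangeSum ((cmResidualSubspace L 2 μ).toContRep.restrict ιK).toRepresentation
            (((cmResidualSubspace L 2 μ).toContRep.restrict ιK).subRep E hE))) :
    ∀ (L : Type) [Field L] [NumberField L] [IsCMField L]
      (μ : Measure (UnitaryGroup.cmDatum L 2 (Matrix.of fun i j : Fin 2 => if i.val + j.val + 1 = 2 then (1 : L) else 0)).automorphicQuotient)
      [(UnitaryGroup.cmDatum L 2 (Matrix.of fun i j : Fin 2 => if i.val + j.val + 1 = 2 then (1 : L) else 0)).IsAutomorphicMeasure μ],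
      K2E1CuspidalSpectrumUnitary.CmResidualSpectrumCompact L 2 μ  := by
  intro L _ _ _ μ _
  obtain ⟨K, _, _, _, _, _, ιK, hι, hadm⟩ := h L μ
  exact residualSpectrumCompact_of_admissible _ μ (cmParabolicData L 2) ιK hι hadm

/-- **SOCKET 12R3 BY NAME: `sig_K2E1ResidualCompactU3R` (Sigs ED. 12 :293, bytes verbatim) ⟸ the `∀ L μ`-package «`L²_res(U(Φ₃)_{L∕L⁺})` (Heisenberg radical of record ★
`cmParabolicDataR L 3`) is `K`-admissible»** (★ `residualSpectrumCompact_of_admissible`). [cite: MoeglinWaldspurger1995, I.2.18 and V.3.13] [cite: Rogawski1990, §13.9 p. 227] -/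
theorem sig_K2E1ResidualCompactU3R_of_admissible
    (h : ∀ (L : Type) [Field L] [NumberField L] [IsCMField L]
      (μ : Measure (UnitaryGroup.cmDatum L 3 (Matrix.of fun i j : Fin 3 => if i.val + j.val + 1 = 3 then (1 : L) else 0)).automorphicQuotient)
      [(UnitaryGroup.cmDatum L 3 (Matrix.of fun i j : Fin 3 => if i.val + j.val + 1 = 3 then (1 : L) else 0)).IsAutomorphicMeasure μ],
      ∃ (K : Type) (_ : Group K) (_ : TopologicalSpace K) (_ : IsTopologicalGroup K) (_ : CompactSpace K) (_ : T2Space K)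
        (ιK : K →* (UnitaryGroup.cmDatum L 3 (Matrix.of fun i j : Fin 3 => if i.val + j.val + 1 = 3 then (1 : L) else 0)).Adelic) (_ : Continuous ιK),
        ∀ (E : Submodule ℂ (cmResidualSubspaceR L 3 μ).toSubmodule) (hE : ∀ k, ∀ x ∈ E, ((cmResidualSubspaceR L 3 μ).toContRep.restrict ιK) k x ∈ E),
          FiniteDimensional ℂ E → (((cmResidualSubspaceR L 3 μ).toContRep.restrict ιK).subRep E hE).IsIrreducible →
          FiniteDimensional ℂ ↥(Representation.homRangeSum ((cmResidualSubspaceR L 3 μ).toContRep.restrict ιK).toRepresentation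
            (((cmResidualSubspaceR L 3 μ).toContRep.restrict ιK).subRep E hE))) :
    ∀ (L : Type) [Field L] [NumberField L] [IsCMField L]
      (μ : Measure (UnitaryGroup.cmDatum L 3 (Matrix.of fun i j : Fin 3 => if i.val + j.val + 1 = 3 then (1 : L) else 0)).automorphicQuotient) [(UnitaryGroup.cmDatum L 3 (Matrix.of fun i j : Fin 3 => if i.val + j.val + 1 = 3 then (1 : L) else 0)).IsAutomorphicMeasure μ],
      K2E1CuspidalSpectrumUnitary.CmResidualSpectrumCompactR L 3 μ  := by
  intro L _ _ _ μ _
  obtain ⟨K, _, _, _, _, _, ιK, hι, hadm⟩ := h L μ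
  exact residualSpectrumCompact_of_admissible _ μ (cmParabolicDataR L 3) ιK hι hadm

/-! ## §2 The same sockets from the package in the `∃`-prefix of ★ `sig_K2E1ResidualCompactU2_of_exp` -/

/-- **SOCKET 5Res BY NAME from the (H4-b)-SHAPED admissibility package** — hypothesis with the `∃`-prefix of ★ `sig_K2E1ResidualCompactU2_of_exp` :45 VERBATIM (Borel structures on the
radicals, a Haar measure `νN` and a fundamental domain `𝓕` of `N(L⁺)` per radical — unused by the admissibility road and discarded) and «`∃ T` finite-dimensional ∋ constant terms»
replaced by «the `E`-isotypic component is finite-dimensional».  [cite: MoeglinWaldspurger1995, I.2.18 and V.3.13] [cite: HarishChandra1968, Thm. 1] -/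
theorem sig_K2E1ResidualCompactU2_of_admissible'
    (h : ∀ (L : Type) [Field L] [NumberField L] [IsCMField L]
      (μ : Measure (UnitaryGroup.cmDatum L 2 (Matrix.of fun i j : Fin 2 => if i.val + j.val + 1 = 2 then (1 : L) else 0)).automorphicQuotient)
      [(UnitaryGroup.cmDatum L 2 (Matrix.of fun i j : Fin 2 => if i.val + j.val + 1 = 2 then (1 : L) else 0)).IsAutomorphicMeasure μ]
      [∀ i, MeasurableSpace ((cmParabolicData L 2).radical i)] [∀ i, BorelSpace ((cmParabolicData L 2).radical i)],
      ∃ (K : Type) (_ : Group K) (_ : TopologicalSpace K) (_ : IsTopologicalGroup K) (_ : CompactSpace K) (_ : T2Space K)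
        (ιK : K →* (UnitaryGroup.cmDatum L 2 (Matrix.of fun i j : Fin 2 => if i.val + j.val + 1 = 2 then (1 : L) else 0)).Adelic) (_ : Continuous ιK)
        (νN : ∀ i, Measure ((cmParabolicData L 2).radical i)) (_ : ∀ i, (νN i).IsHaarMeasure)
        (𝓕 : ∀ i, Set ((cmParabolicData L 2).radical i)) (_ : ∀ i, IsFundamentalDomain ((cmParabolicData L 2).rational i) (𝓕 i) (νN i)),
        ∀ (E : Submodule ℂ (cmResidualSubspace L 2 μ).toSubmodule) (hE : ∀ k, ∀ x ∈ E, ((cmResidualSubspace L 2 μ).toContRep.restrict ιK) k x ∈ E),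
          FiniteDimensional ℂ E → (((cmResidualSubspace L 2 μ).toContRep.restrict ιK).subRep E hE).IsIrreducible →
          FiniteDimensional ℂ ↥(Representation.homRangeSum ((cmResidualSubspace L 2 μ).toContRep.restrict ιK).toRepresentation
            (((cmResidualSubspace L 2 μ).toContRep.restrict ιK).subRep E hE))) :
    ∀ (L : Type) [Field L] [NumberField L] [IsCMField L]
      (μ : Measure (UnitaryGroup.cmDatum L 2 (Matrix.of fun i j : Fin 2 => if i.val + j.val + 1 = 2 then (1 : L) else 0)).automorphicQuotient)
      [(UnitaryGroup.cmDatum L 2 (Matrix.of fun i j : Fin 2 => if i.val + j.val + 1 = 2 then (1 : L) else 0)).IsAutomorphicMeasure μ],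
      K2E1CuspidalSpectrumUnitary.CmResidualSpectrumCompact L 2 μ  :=
  sig_K2E1ResidualCompactU2_of_admissible fun L _ _ _ μ _ => by
    letI : ∀ i, MeasurableSpace ((cmParabolicData L 2).radical i) := fun i => borel _
    haveI : ∀ i, BorelSpace ((cmParabolicData L 2).radical i) := fun i => ⟨rfl⟩
    obtain ⟨K, i₁, i₂, i₃, i₄, i₅, ιK, hι, -, -, -, -, hadm⟩ := h L μ
    exact ⟨K, i₁, i₂, i₃, i₄, i₅, ιK, hι, hadm⟩

/-- **SOCKET 12R3 BY NAME from the (H4-b)-SHAPED admissibility package** (`∃`-prefix of ★ `sig_K2E1ResidualCompactU3R_of_exp` VERBATIM, isotypic finite-dimensionality in place of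
`∃ T`). [cite: MoeglinWaldspurger1995, I.2.18 and V.3.13] [cite: Rogawski1990, §13.9 p. 227] -/
theorem sig_K2E1ResidualCompactU3R_of_admissible'
    (h : ∀ (L : Type) [Field L] [NumberField L] [IsCMField L]
      (μ : Measure (UnitaryGroup.cmDatum L 3 (Matrix.of fun i j : Fin 3 => if i.val + j.val + 1 = 3 then (1 : L) else 0)).automorphicQuotient)
      [(UnitaryGroup.cmDatum L 3 (Matrix.of fun i j : Fin 3 => if i.val + j.val + 1 = 3 then (1 : L) else 0)).IsAutomorphicMeasure μ]
      [∀ i, MeasurableSpace ((cmParabolicDataR L 3).radical i)] [∀ i, BorelSpace ((cmParabolicDataR L 3).radical i)],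
      ∃ (K : Type) (_ : Group K) (_ : TopologicalSpace K) (_ : IsTopologicalGroup K) (_ : CompactSpace K) (_ : T2Space K)
        (ιK : K →* (UnitaryGroup.cmDatum L 3 (Matrix.of fun i j : Fin 3 => if i.val + j.val + 1 = 3 then (1 : L) else 0)).Adelic) (_ : Continuous ιK)
        (νN : ∀ i, Measure ((cmParabolicDataR L 3).radical i)) (_ : ∀ i, (νN i).IsHaarMeasure)
        (𝓕 : ∀ i, Set ((cmParabolicDataR L 3).radical i)) (_ : ∀ i, IsFundamentalDomain ((cmParabolicDataR L 3).rational i) (𝓕 i) (νN i)),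
        ∀ (E : Submodule ℂ (cmResidualSubspaceR L 3 μ).toSubmodule) (hE : ∀ k, ∀ x ∈ E, ((cmResidualSubspaceR L 3 μ).toContRep.restrict ιK) k x ∈ E),
          FiniteDimensional ℂ E → (((cmResidualSubspaceR L 3 μ).toContRep.restrict ιK).subRep E hE).IsIrreducible →
          FiniteDimensional ℂ ↥(Representation.homRangeSum ((cmResidualSubspaceR L 3 μ).toContRep.restrict ιK).toRepresentation
            (((cmResidualSubspaceR L 3 μ).toContRep.restrict ιK).subRep E hE))) :
    ∀ (L : Type) [Field L] [NumberField L] [IsCMField L]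
      (μ : Measure (UnitaryGroup.cmDatum L 3 (Matrix.of fun i j : Fin 3 => if i.val + j.val + 1 = 3 then (1 : L) else 0)).automorphicQuotient) [(UnitaryGroup.cmDatum L 3 (Matrix.of fun i j : Fin 3 => if i.val + j.val + 1 = 3 then (1 : L) else 0)).IsAutomorphicMeasure μ],
      K2E1CuspidalSpectrumUnitary.CmResidualSpectrumCompactR L 3 μ  :=
  sig_K2E1ResidualCompactU3R_of_admissible fun L _ _ _ μ _ => by
    letI : ∀ i, MeasurableSpace ((cmParabolicDataR L 3).radical i) := fun i => borel _
    haveI : ∀ i, BorelSpace ((cmParabolicDataR L 3).radical i) := fun i => ⟨rfl⟩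
    obtain ⟨K, i₁, i₂, i₃, i₄, i₅, ιK, hι, -, -, -, -, hadm⟩ := h L μ
    exact ⟨K, i₁, i₂, i₃, i₄, i₅, ιK, hι, hadm⟩

end Summit.HodgeConjecture.HodgeConjecture.Cruxes.H413.K2E1ResidualCompactOfAdmissibleU2

end
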